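import Literature.MathematicalPhysics.QuantumFieldTheory.Balaban1983to89.B8Prop3GaugeFixedKLevelSrcGammaPrime
import Literature.MathematicalPhysics.QuantumFieldTheory.Balaban1983to89.B8Thm4SupportLocalPer
import Literature.MathematicalPhysics.QuantumFieldTheory.Balaban1983to89.B8PeriodicMemberGeometry

/-!
# `Balaban1983to89.B8Prop3GaugeFixedKLevelSrcGammaPer` — [Balaban1985RegularSpaces] THEOREM 4 ∕ THEOREM 8's EXISTENCE INDUCTION (edition γ′, sourced reset) **WITH THE
# PERIODICITY INVARIANT**: Proposition 3's reset server called at PERIODIC `(u, W, A′)` from a PERIODIC-GUARDED sourced in-edge `H59src` ([4] Thm 3.3 with source at periodic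
# arguments only), and the all-levels composition — dag-n05-d's `B8Prop3GaugeFixedKLevelSrcGamma.hP3_gaugeFixed_of_b9_src_γ` ∕ `…SrcGammaPrime.thm4_exists_all_levels_supp_src_γ'`
# RE-RUN on this seat's periodicity-threaded driver `B8Thm4SupportLocalPer.thm4_exists_all_levels_supp_per` (bricks T2 + T3 of the periodic-argument edition of Theorems 2 ∕ 4 ∕ 8)

statement-level skeleton of published theorems with citation tags; proofs where landed; nothing here is a claim about the Yang–Mills mass gap

T. Bałaban, *Spaces of regular gauge field configurations on a lattice and gauge fixing conditions*, Commun. Math. Phys. **99** (1985) 75–102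
`[Balaban1985RegularSpaces]` ("B8"): Thm 4 p. 88, proof pp. 88–89 ∕ 94–95, Prop. 3 p. 87, (1.55)–(1.62) pp. 86–87, (1.40)–(1.42) p. 83, Thm 8 (1.146) p. 101, p. 77 («Ω_j ⊂ T_η»).
`[Balaban1985BackgroundPropagators]` ("[4]") Thm 3.3 p. 398 (the in-edge behind (1.57)–(1.59)).  `[Balaban1985Averaging]` (4) p. 18 (the torus).

## WHY THIS FILE (cell `pub-ymgap`, HUMAN RULING D-0062; width seat `pub-ymgap-dag-n05-w1` (g4); bricks T2 ∕ T3 of the package «N05-(β′)-GT», plan g87 SCOPE WORD v2 2026-08-28 15:56Z «GO TO FILE»;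
## director-ym №217 (1)(b))

`B8Thm4SupportLocalPer` threads PERIODICITY through Theorem 4's level induction: Proposition 5 is asked at periodic data and the reset socket `hP3` (Proposition 3 for gauge-fixed fields,
the constant reset of (1.111)) at periodic `(u, W, A)` only.  That reset is SERVED, on the `Ω₀ = ℤᵈ` road, by dag-n05-d's `hP3_gaugeFixed_of_b9_src_γ` from two member hypotheses: the
(1.42) clause `H42` (dag-n05-w2's THEOREM `H42_of_inAx_γ'`, quantified over all fields — harmless) and the SOURCED in-edge `H59src` = [4] Thm 3.3 with source, quantified over ALL
`(u, W, A′)` on `ℤᵈ` — infinite volume, not suppliable by torus objects.  The server calls `H59src` EXACTLY ONCE, at `(u, W, A′ := masked (1∕iη) log W)`; for periodic `u, W` over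
periodic domains that exponent is periodic (the mask of `Ω_j`-touching bonds translates — dag-n05-w2's `B8PeriodicMemberGeometry.sideTouchesMask_add_zsmul_iff` — and the logarithm is
bondwise), so a PERIODIC-GUARDED `H59src` suffices — the same device as this seat's `B8LeafModelZdPerProp3OfSockPer` ∕ `B8Prop3PrintedZdGF3P2GammaOfSockPer` for Proposition 3.
§2 composes: Theorem 4's ∕ Theorem 8's existence half at all levels for PERIODIC `U₀`, `U′` with EVERY socket (`hP5base`, `hP5`, `H59src`) asked at periodic arguments only and the
produced `u`, `W = U′^{u⁻¹}`, exponent `A` periodic — the engine the periodic-family Theorem-4∕8 core (T4–T6) will read.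

## WHAT IS PROVED (kernel, 0 sorry, 0 def)

* §1 ★ `hP3_gaugeFixed_of_b9_src_γ_per` — dag-n05-d's reset server VERBATIM with: the period `P` and the periodicity of `Ω_j` (`j ≤ k`) as hypotheses, the sourced in-edge GUARDED
  (`IsPeriodic P u → IsPeriodic P W → IsPeriodic P A′ →`), the served `hP3` in `B8Thm4SupportLocalPer`'s shape (asked at periodic `(u, W, A)`); ONE new `have` (periodicity of the
  masked exponent).
* §2 ★★ `thm4_exists_all_levels_supp_src_γ'_per` — dag-n05-d's `thm4_exists_all_levels_supp_src_γ'` VERBATIM with: `IsPeriodic P U₀`, `IsPeriodic P U′`, periodic `Ω_j`; Prop-5 sockets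
  assuming a periodic level datum and delivering `IsPeriodic P v`; `H59src` guarded; CONCLUSION at every `m ≤ k`: `u`, `W`, `A` as before AND `IsPeriodic P u ∧ IsPeriodic P W ∧
  IsPeriodic P A`; (1.42) by `H42_of_inAx_γ'` unchanged.

## HONEST SCOPE

Re-runs of LANDED assemblies with periodicity threads; Propositions 3 ∕ 5, (1.42), [4] Thm 3.3 are NOT re-proved (n05-b ∕ n04-b ∕ n05-w1-g0 ∕ n05-w2 engines BY NAME; Prop 5 and the
sourced in-edge remain HYPOTHESES, now at periodic arguments); the uniqueness half, the windows ∕ thresholds wrapper (`thm4Body_concrete_uniform_lanE_γ'`) and the member cores are the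
next bricks (T4–T6), NOT here; count-neutral helper (K1⁹ `stmt-QuantumFields-27364`); N05 NOT discharged; no count claim; one finite `𝕋⁴` programme at fixed `ε`, Bałaban AS PRINTED;
the Yang–Mills mass gap (Clay) is NOT proved by any of this — R4 closes the conditional finite-`𝕋⁴` rung `BalabanLadder.UV` only; nothing continuum ∕ ℝ⁴ ∕ OS.  No `sorry`, no `def`,
no `instance`, no `notation`.  Unit `pub-ymgap-dag-n05-w1` (g4), 2026-08-28.

[cite: Balaban1985RegularSpaces, Thm 4 p.88, pp.88–89 + 94–95, Prop. 3 p.87, (1.55)–(1.62) pp.86–87, (1.40)–(1.42) p.83, Thm 8 (1.146) p.101, p.77; Balaban1985BackgroundPropagators, Thm 3.3 p.398]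
-/

noncomputable section

open NormedSpace

namespace Literature.MathematicalPhysics.QuantumFieldTheory.Balaban1983to89.B8Prop3GaugeFixedKLevelSrcGammaPer

open Complex (I I_ne_zero)
open MatrixLog B7Prop1Explicit B7Prop2Explicit B7Prop1Local B7Eq92Concrete
open B7Prop2Explicit (C0 c2' unitaryUnits unitaryUnits_le_U1 avgClosed_unitaryUnits)
open B8Lemma1NonAbelian (mulCfg)
open B8Ineq132 (covDerivFwd covDeriv covDiv plaqF InAk CondAt BondTouches PlaqTouches)
open B8Eq140Level (SideTouches)
open B8Eq119TwistedAxial (Restr129 InAx)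
open B8Eq184Proof (gaugeExp cfgExp)
open B8Eq146AExpansion (iEta expCfg)
open B7Prop4GeneralLevels (logCovIter linCovIter)
open B8Eq155JBound (Jcur wsup)
open B8ScaledSupNorm (bondNorm msup weight Bdd)
open B7Prop3Flat (c3)
open B7Eq78Linearization (conjR)
open B8Thm2LogB (blockTop)
open B8Ineq130 (tlo thi)
open B8Prop3GaugeFixedKLevel (logField_spec mem_unitaryUnits_of_mgauge_eq cfgExp_congr_at inAk_congr_of_sideTouches
  mulCfg_eq_gaugeAct_of_mgauge_eq expCfg_iEta_eq_cfgExp)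
open B8Prop3GaugeFixedKLevelSrcGamma (prop3_normA_kLevel_src_γ)
open B8Thm4SupportLocalPer (thm4_exists_all_levels_supp_per)
open T4TermwiseTorus (IsPeriodic)

-- `Site` alone could resolve to the torus sites of `Setup.lean`; re-export the `ℤ^d` sites of `B7Prop1Explicit`.
export B7Prop1Explicit (Site)

variable {d : ℕ}

/-! ## §1 The reset server at periodic data, sourced in-edge guarded -/

section Reset

variable {𝔸 : Type*} [CStarAlgebra 𝔸] [Nontrivial 𝔸]

/-- ★ **PROPOSITION 3's RESET FOR GAUGE-FIXED FIELDS, SOURCED (1.59), EDITION γ — SERVED AT PERIODIC DATA FROM A PERIODIC-GUARDED IN-EDGE** (`B8Prop3GaugeFixedKLevelSrcGamma.hP3_gaugeFixed_of_b9_src_γ`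
re-run): for `P`-periodic `u`, `W` over `P`-periodic domains `Ω_j` the masked exponent `A′ := (1∕iη) log W` on the `Ω_j`-touching bonds is `P`-periodic, so the sourced in-edge `H59src` and the
(1.42) clause are asked at that periodic triple only; the rest — (1.40) for `e^{iηA′}U₀` by locality, the gradient datum, n05-b's `prop3_norms_kLevel` in the sourced γ form, (1.62) ⇒ the reset
`‖A‖ ≤ c⋆(Lʲη)⁻¹` — verbatim. [cite: Balaban1985RegularSpaces, Prop. 3 p.87, (1.55)–(1.62) pp.86–87, (1.40)–(1.42) p.83, Thm 8 p.101, p.77 («Ω_j ⊂ T_η»); Balaban1985BackgroundPropagators, Thm 3.3 p.398] -/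
theorem hP3_gaugeFixed_of_b9_src_γ_per (hd2 : 2 ≤ d) {η : ℝ} (hη : 0 < η) {L : ℕ} (hL : 2 ≤ L) (k : ℕ)
    {U₀ U' : Site d → Fin d → 𝔸ˣ} (hU₀ : ∀ x κ, U₀ x κ ∈ unitaryUnits 𝔸) (hU' : ∀ x κ, U' x κ ∈ unitaryUnits 𝔸)
    {α₀ α₁ α₄ B₀ cstar : ℝ} (hα₀ : 0 < α₀) (hα₁ : 0 ≤ α₁) (hα₄ : 0 ≤ α₄) (hB₀ : 0 ≤ B₀)
    {Ta Tg : ℝ} (hTa : 0 ≤ Ta) (hTg : 0 ≤ Tg) (hc : 5 * d * L * B₀ * (α₀ + α₁) + (Ta + Tg) ≤ cstar)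
    -- [3] Prop. 4's linearisation windows ONE LEVEL LOWER (edition γ)
    (hα3 : C0 d * ((L : ℝ) ^ 2 * α₀) ≤ 1 / 3) (hα4 : 4 * ((L : ℝ) ^ 2 * α₀) ≤ c2' d L)
    (h16 : 16 * (2 * (L * cstar) + 8 * α₄) ≤ 1) (hd5 : 5 * (2 * (L * cstar) + 8 * α₄) * ((d : ℝ) - 1) ≤ 4)
    (hsmall : Real.exp (4 * (800 * ((d : ℝ) + 1) ^ 2 * ((d : ℝ) + 4)) * ((L : ℝ) ^ 2 * α₀))
      * (1 + 8 * (131072 * ((d : ℝ) + 1) ^ 2) * ((L : ℝ) * (2 * (L * cstar) + 8 * α₄))) ≤ 2)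
    (hc₃ : 2 * ((L : ℝ) * (2 * (L * cstar) + 8 * α₄)) ≤ c3 d L) (hside : 36 * d * B₀ * (2 * (L * cstar) + 8 * α₄) ≤ 1 / 2)
    (h50 : 50 * d * (2 * (L * cstar) + 8 * α₄) ≤ 1)
    {C₂ : ℝ} (hC₂ : 8 * (131072 * ((d : ℝ) + 1) ^ 2) * Real.exp (4 * (800 * ((d : ℝ) + 1) ^ 2 * ((d : ℝ) + 4)) * ((L : ℝ) ^ 2 * α₀)) * (L : ℝ) ^ 2 ≤ C₂)
    (h61 : 2 * (2 * (L * cstar) + 8 * α₄) ^ 2 + 20 * d * α₀ * (2 * (L * cstar) + 8 * α₄)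
      + 2 * C₂ * (2 * (L * cstar) + 8 * α₄) ^ 2 ≤ α₀ + α₁)
    (Ω : ℕ → Set (Site d)) (Λs : ℕ → ℕ → Set (Site d)) (Λb : ℕ → ℕ → Set (Site d × Fin d))
    -- the torus read on `ℤᵈ`: the period `P` and the `P`-periodicity of the domains `Ω_j`, `j ≤ k` (NODE 00's periodic (1.5)-index law)
    (P : ℕ) (hΩp : ∀ j, j ≤ k → IsPeriodic P (fun x : Site d => x ∈ Ω j))
    -- PRINT's box law (edition γ): the locality box of a level-`j` datum bond lies in `Ω_{j−1}` ((1.31); level 0: `Ω₀`)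
    (hbox : ∀ m, m ≤ k → ∀ j, j ≤ m → ∀ c ∈ Λb m j, ∀ x, InBox (loK L j c.1) (bondHiK L j c.1 c.2) x → x ∈ Ω (j - 1))
    (h33 : InAk L k η α₀ Ω U₀) (h34 : InAk L k η α₀ Ω (mulCfg U' U₀))
    (Lan : ℕ → (Site d → Fin d → 𝔸ˣ) → Prop)
    (H42 : ∀ m, 1 ≤ m → m ≤ k → ∀ (u : Site d → 𝔸ˣ) (W : Site d → Fin d → 𝔸ˣ) (A' : Site d → Fin d → 𝔸),
      (∀ x, u x ∈ unitaryUnits 𝔸) → mgauge U₀ u W = U' → Restr129 L m (Λs m) U₀ u → Lan m W →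
      (∀ y τ, IsSelfAdjoint (A' y τ)) →
      (∀ j, j ≤ m → ∀ y τ, SideTouches (Ω j) y τ →
        W y τ = cfgExp η A' y τ ∧ ‖A' y τ‖ ≤ (2 * (L * cstar) + 8 * α₄) * ((L : ℝ) ^ j * η)⁻¹) →
      (∀ y τ, (∀ j, j ≤ m → ¬ SideTouches (Ω j) y τ) → A' y τ = 0) →
      ∀ j, j ≤ m → ∀ c ∈ Λb m j, ‖logCovIter L U₀ (iEta η A') j c.1 c.2‖ < 2 * d * L * α₁)
    (H59 : ∀ m, 1 ≤ m → m ≤ k → ∀ (u : Site d → 𝔸ˣ) (W : Site d → Fin d → 𝔸ˣ) (A' : Site d → Fin d → 𝔸),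
      (∀ x, u x ∈ unitaryUnits 𝔸) → IsPeriodic P u → IsPeriodic P W → IsPeriodic P A' →
      mgauge U₀ u W = U' → Restr129 L m (Λs m) U₀ u → Lan m W →
      (∀ y τ, IsSelfAdjoint (A' y τ)) →
      (∀ j, j ≤ m → ∀ y τ, SideTouches (Ω j) y τ →
        W y τ = cfgExp η A' y τ ∧ ‖A' y τ‖ ≤ (2 * (L * cstar) + 8 * α₄) * ((L : ℝ) ^ j * η)⁻¹) →
      (∀ y τ, (∀ j, j ≤ m → ¬ SideTouches (Ω j) y τ) → A' y τ = 0) →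
      msup L m η (-(1 : ℝ)) (fun j (b : Site d × Fin d) => SideTouches (Ω j) b.1 b.2) (fun b => A' b.1 b.2)
          ≤ B₀ * (bondNorm L m η (-(3 : ℝ)) Ω (fun x μ => Jcur η U₀ A' μ x)
            + wsup 1 (fun p : {p : ℕ × (Site d × Fin d) // p.1 ≤ m ∧ p.2 ∈ Λb m p.1} =>
                linCovIter L U₀ (iEta η A') p.1.1 p.1.2.1 p.1.2.2)) + Ta ∧
        msup L m η (-(2 : ℝ)) (fun j (t : Fin d × Fin d × Site d) => SideTouches (Ω j) t.2.2 t.2.1)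
            (fun t => covDerivFwd η U₀ t.1 (fun z => A' z t.2.1) t.2.2)
          ≤ B₀ * (bondNorm L m η (-(3 : ℝ)) Ω (fun x μ => Jcur η U₀ A' μ x)
            + wsup 1 (fun p : {p : ℕ × (Site d × Fin d) // p.1 ≤ m ∧ p.2 ∈ Λb m p.1} =>
                linCovIter L U₀ (iEta η A') p.1.1 p.1.2.1 p.1.2.2)) + Tg) :
    ∀ m, 1 ≤ m → m ≤ k → ∀ (u : Site d → 𝔸ˣ) (W : Site d → Fin d → 𝔸ˣ) (A : Site d → Fin d → 𝔸),
      (∀ x, u x ∈ unitaryUnits 𝔸) → IsPeriodic P u → IsPeriodic P W → IsPeriodic P A →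
      mgauge U₀ u W = U' → Restr129 L m (Λs m) U₀ u → Lan m W →
      (∀ j, j ≤ m → ∀ b ∈ {b : Site d × Fin d | SideTouches (Ω j) b.1 b.2},
        W b.1 b.2 = cfgExp η A b.1 b.2 ∧ ‖A b.1 b.2‖ ≤ (2 * (L * cstar) + 8 * α₄) * ((L : ℝ) ^ j * η)⁻¹) →
      ∀ j, j ≤ m → ∀ b ∈ {b : Site d × Fin d | SideTouches (Ω j) b.1 b.2},
        ‖A b.1 b.2‖ ≤ cstar * ((L : ℝ) ^ j * η)⁻¹ := by
  intro m hm1 hmk u W A hu hup hWp _ hW h129 hLan hWA j₀ hj₀ b₀ hb₀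
  have hL1 : 1 ≤ L := le_trans (by norm_num) hL
  have hLr : (1 : ℝ) ≤ L := by exact_mod_cast hL1
  set α₂ : ℝ := 2 * (L * cstar) + 8 * α₄ with hα₂_def
  have hcstar : 0 ≤ cstar := le_trans (by positivity) hc
  have hα₂ : 0 ≤ α₂ := by positivity
  have hα₂16 : α₂ ≤ 1 / 16 := by linarith
  -- `W` is unitary-valued
  have hWu : ∀ x κ, W x κ ∈ unitaryUnits 𝔸 := mem_unitaryUnits_of_mgauge_eq hU₀ hU' hu hW
  -- the bonds where the socket delivers `W = e^{iηA}`
  set M : Set (Site d × Fin d) := {b | ∃ j, j ≤ m ∧ SideTouches (Ω j) b.1 b.2} with hM_def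
  -- the masked exponent field `A′ := (1/iη) log W` on `M`, `0` elsewhere
  set A' : Site d → Fin d → 𝔸 :=
    fun y τ => M.indicator (fun b : Site d × Fin d => η⁻¹ • ((I⁻¹ : ℂ) • mlog ((W b.1 b.2 : 𝔸ˣ) : 𝔸))) (y, τ) with hA'_def
  -- on a socket bond: `A′ = A`, self-adjoint, `W = e^{iηA′}`
  have hsock : ∀ j, j ≤ m → ∀ y τ, SideTouches (Ω j) y τ →
      A' y τ = A y τ ∧ IsSelfAdjoint (A' y τ) ∧ W y τ = cfgExp η A' y τ := by
    intro j hj y τ hs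
    have hmem : (y, τ) ∈ M := ⟨j, hj, hs⟩
    obtain ⟨hWA₁, hA₁⟩ := hWA j hj (y, τ) hs
    have hLj : (1 : ℝ) ≤ (L : ℝ) ^ j := one_le_pow₀ hLr
    have hA₂ : ‖A y τ‖ ≤ α₂ * η⁻¹ := by
      calc ‖A y τ‖ ≤ α₂ * ((L : ℝ) ^ j * η)⁻¹ := hA₁
        _ = α₂ * η⁻¹ * ((L : ℝ) ^ j)⁻¹ := by rw [mul_inv]; ring
        _ ≤ α₂ * η⁻¹ * 1 := by
            apply mul_le_mul_of_nonneg_left (inv_le_one_of_one_le₀ hLj) (by positivity)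
        _ = α₂ * η⁻¹ := mul_one _
    obtain ⟨hlog, hsa, hexp⟩ := logField_spec hη U₀ hWu hWA₁ hA₂ hα₂16
    have hA'y : A' y τ = η⁻¹ • ((I⁻¹ : ℂ) • mlog ((W y τ : 𝔸ˣ) : 𝔸)) := by
      simp only [hA'_def, Set.indicator_of_mem hmem]
    refine ⟨by rw [hA'y, hlog], by rw [hA'y]; exact hsa, ?_⟩
    rw [hexp]
    exact cfgExp_congr_at η hA'y.symm
  have hA'0 : ∀ y τ, (∀ j, j ≤ m → ¬ SideTouches (Ω j) y τ) → A' y τ = 0 := by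
    intro y τ h
    have hnot : (y, τ) ∉ M := fun ⟨j, hj, hs⟩ => h j hj hs
    simp only [hA'_def, Set.indicator_of_notMem hnot]
  have hA'sa : ∀ y τ, IsSelfAdjoint (A' y τ) := by
    intro y τ
    by_cases hmem : (y, τ) ∈ M
    · obtain ⟨j, hj, hs⟩ := hmem
      exact (hsock j hj y τ hs).2.1
    · have : A' y τ = 0 := by simp only [hA'_def, Set.indicator_of_notMem hmem]
      rw [this]; exact IsSelfAdjoint.zero 𝔸
  have hA'41 : ∀ j, j ≤ m → ∀ y τ, SideTouches (Ω j) y τ →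
      W y τ = cfgExp η A' y τ ∧ ‖A' y τ‖ ≤ α₂ * ((L : ℝ) ^ j * η)⁻¹ := by
    intro j hj y τ hs
    obtain ⟨hAA, -, hWe⟩ := hsock j hj y τ hs
    exact ⟨hWe, by rw [hAA]; exact (hWA j hj (y, τ) hs).2⟩
  -- global bound `‖A′‖ ≤ α₂η⁻¹`
  have hA'glob : ∀ y τ, ‖A' y τ‖ ≤ α₂ * η⁻¹ := by
    intro y τ
    by_cases hmem : (y, τ) ∈ M
    · obtain ⟨j, hj, hs⟩ := hmem
      have hLj : (1 : ℝ) ≤ (L : ℝ) ^ j := one_le_pow₀ hLr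
      calc ‖A' y τ‖ ≤ α₂ * ((L : ℝ) ^ j * η)⁻¹ := (hA'41 j hj y τ hs).2
        _ = α₂ * η⁻¹ * ((L : ℝ) ^ j)⁻¹ := by rw [mul_inv]; ring
        _ ≤ α₂ * η⁻¹ * 1 := by
            apply mul_le_mul_of_nonneg_left (inv_le_one_of_one_le₀ hLj) (by positivity)
        _ = α₂ * η⁻¹ := mul_one _
    · have : A' y τ = 0 := by simp only [hA'_def, Set.indicator_of_notMem hmem]
      rw [this, norm_zero]; positivity
  -- the in-edge (1.59) and the (1.42) clause for `A′`
  -- THE PERIODICITY THREAD: the masked exponent `A′` of the periodic `W` over the periodic domains `Ω_j`, `j ≤ m`, is periodic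
  have hA'p : IsPeriodic P A' := by
    intro y mv
    funext τ
    have hM : ((y + (P : ℤ) • mv, τ) ∈ M) ↔ ((y, τ) ∈ M) :=
      B8PeriodicMemberGeometry.sideTouchesMask_add_zsmul_iff (fun j hj => hΩp j (hj.trans hmk)) y mv τ
    by_cases hmem : (y, τ) ∈ M
    · simp only [hA'_def, Set.indicator_of_mem hmem, Set.indicator_of_mem (hM.2 hmem), congrFun (hWp y mv) τ]
    · simp only [hA'_def, Set.indicator_of_notMem hmem, Set.indicator_of_notMem (fun h => hmem (hM.1 h))]
  obtain ⟨h59a, h59g⟩ := H59 m hm1 hmk u W A' hu hup hWp hA'p hW h129 hLan hA'sa hA'41 hA'0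
  have h42 := H42 m hm1 hmk u W A' hu hW h129 hLan hA'sa hA'41 hA'0
  -- (1.40) for `U₀` and for `e^{iηA′}U₀` at the `m` levels
  have h40₀ : InAk L m η α₀ Ω U₀ := fun j hj => h33 j (hj.trans hmk)
  have h40W : InAk L m η α₀ Ω (mulCfg W U₀) := by
    have h1 : InAk L m η α₀ Ω (mulCfg U' U₀) := fun j hj => h34 j (hj.trans hmk)
    have hui : ∀ x, u⁻¹ x ∈ U1 𝔸 := fun x => unitaryUnits_le_U1 ((unitaryUnits 𝔸).inv_mem (hu x))
    rw [mulCfg_eq_gaugeAct_of_mgauge_eq hW]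
    exact (B8Ineq132.inAk_gaugeAct_iff L m η α₀ Ω hui _).2 h1
  have h40₁ : InAk L m η α₀ Ω (mulCfg (expCfg (iEta η A')) U₀) := by
    refine (inAk_congr_of_sideTouches L m η α₀ (V := mulCfg W U₀) fun j hj y τ hs => ?_).1 h40W
    show W y τ * U₀ y τ = expCfg (iEta η A') y τ * U₀ y τ
    rw [(hA'41 j hj y τ hs).1, expCfg_iEta_eq_cfgExp]
  -- boundedness of the two weighted families and the gradient datum
  have hBa : Bdd L m η (-(1 : ℝ)) (fun j (b : Site d × Fin d) => SideTouches (Ω j) b.1 b.2) fun b => A' b.1 b.2 := by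
    have e1 : (-(1 : ℝ)) = -((1 : ℕ) : ℝ) := by norm_num
    rw [e1]
    refine B8ScaledSupNorm.bdd_of_forall (c := α₂) fun j hj b hb => ?_
    have hs : 0 < (L : ℝ) ^ j * η := B8ScaledSupNorm.scale_pos hL1 hη j
    rw [B8ScaledSupNorm.weight_neg_natCast L η 1 j, pow_one]
    calc (L : ℝ) ^ j * η * ‖A' b.1 b.2‖ ≤ (L : ℝ) ^ j * η * (α₂ * ((L : ℝ) ^ j * η)⁻¹) :=
        mul_le_mul_of_nonneg_left (hA'41 j hj b.1 b.2 hb).2 hs.le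
      _ = α₂ := by field_simp
  have hU₀1 : ∀ x κ, U₀ x κ ∈ U1 𝔸 := fun x κ => unitaryUnits_le_U1 (hU₀ x κ)
  have hgrad : ∀ (y : Site d) (κ τ : Fin d), ‖covDerivFwd η U₀ κ (fun z => A' z τ) y‖ ≤ 2 * α₂ * η⁻¹ * η⁻¹ := by
    intro y κ τ
    unfold covDerivFwd
    rw [norm_smul, norm_inv, Real.norm_eq_abs, abs_of_pos hη]
    have h1 : ‖conjR (U₀ y κ) (A' (y + e κ) τ) - A' y τ‖ ≤ α₂ * η⁻¹ + α₂ * η⁻¹ := by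
      calc ‖conjR (U₀ y κ) (A' (y + e κ) τ) - A' y τ‖
          ≤ ‖conjR (U₀ y κ) (A' (y + e κ) τ)‖ + ‖A' y τ‖ := norm_sub_le _ _
        _ ≤ α₂ * η⁻¹ + α₂ * η⁻¹ := by
            rw [B8Ineq132.norm_conjR (hU₀1 y κ)]
            exact add_le_add (hA'glob _ _) (hA'glob _ _)
    calc η⁻¹ * ‖conjR (U₀ y κ) (A' (y + e κ) τ) - A' y τ‖ ≤ η⁻¹ * (α₂ * η⁻¹ + α₂ * η⁻¹) :=
        mul_le_mul_of_nonneg_left h1 (by positivity)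
      _ = 2 * α₂ * η⁻¹ * η⁻¹ := by ring
  have hBg : Bdd L m η (-(2 : ℝ)) (fun j (t : Fin d × Fin d × Site d) => SideTouches (Ω j) t.2.2 t.2.1)
      (fun t => covDerivFwd η U₀ t.1 (fun z => A' z t.2.1) t.2.2) := by
    have e2 : (-(2 : ℝ)) = -((2 : ℕ) : ℝ) := by norm_num
    rw [e2]
    refine B8ScaledSupNorm.bdd_of_forall (c := 2 * α₂ * ((L : ℝ) ^ m) ^ 2) fun j hj t _ => ?_
    rw [B8ScaledSupNorm.weight_neg_natCast L η 2 j]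
    have hLjm : (L : ℝ) ^ j ≤ (L : ℝ) ^ m := pow_le_pow_right₀ hLr hj
    have hLj0 : (0 : ℝ) ≤ (L : ℝ) ^ j := by positivity
    calc ((L : ℝ) ^ j * η) ^ 2 * ‖covDerivFwd η U₀ t.1 (fun z => A' z t.2.1) t.2.2‖
        ≤ ((L : ℝ) ^ j * η) ^ 2 * (2 * α₂ * η⁻¹ * η⁻¹) := mul_le_mul_of_nonneg_left (hgrad _ _ _) (by positivity)
      _ = 2 * α₂ * ((L : ℝ) ^ j) ^ 2 := by field_simp
      _ ≤ 2 * α₂ * ((L : ℝ) ^ m) ^ 2 := by gcongr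
  set g : ℝ := msup L m η (-(2 : ℝ)) (fun j (t : Fin d × Fin d × Site d) => SideTouches (Ω j) t.2.2 t.2.1)
      (fun t => covDerivFwd η U₀ t.1 (fun z => A' z t.2.1) t.2.2) with hg_def
  have hg0 : 0 ≤ g := B8ScaledSupNorm.msup_nonneg L m hη.le _ _ _
  have hg : ∀ j, j ≤ m → ∀ (y : Site d) (κ τ : Fin d), SideTouches (Ω j) y τ →
      ((L : ℝ) ^ j * η) ^ 2 * ‖covDerivFwd η U₀ κ (fun z => A' z τ) y‖ ≤ g := by
    intro j hj y κ τ hs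
    have h := B8ScaledSupNorm.weight_mul_norm_le_msup hBg hj (i := (κ, τ, y)) hs
    have hw : weight L η (-(2 : ℝ)) j = ((L : ℝ) ^ j * η) ^ 2 := by
      have e2 : (-(2 : ℝ)) = -((2 : ℕ) : ℝ) := by norm_num
      rw [e2, B8ScaledSupNorm.weight_neg_natCast L η 2 j]
    rw [hw] at h
    exact h
  -- PROPOSITION 3 at `m` levels for `A′` (n05-b's `prop3_norms_kLevel`)
  obtain ⟨ha, -⟩ := prop3_normA_kLevel_src_γ hd2 hη hL hU₀ hA'sa hα₀ hα₁ hα₂ hg0 hα3 hα4 h16 hd5 hsmall hc₃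
    hB₀ hside h50 hC₂ h61 (hbox m hmk) h40₀ h40₁ (fun j hj y τ hs => (hA'41 j hj y τ hs).2) hg h42 h59a h59g
  -- pointwise on the socket bond, and back to `A`
  have hpt := B8ScaledSupNorm.norm_le_of_msup_le hL1 hη hBa ha hj₀ (i := b₀) hb₀
  rw [Real.rpow_neg_one] at hpt
  obtain ⟨hAA, -, -⟩ := hsock j₀ hj₀ b₀.1 b₀.2 hb₀
  rw [← hAA]
  exact hpt.trans (mul_le_mul_of_nonneg_right hc (by positivity))

end Reset

/-! ## §2 Theorem 4's ∕ Theorem 8's existence induction at all levels, periodic data, every socket at periodic arguments -/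

section Composition

variable {𝔸 : Type*} [CStarAlgebra 𝔸] [Nontrivial 𝔸]

/-- ★★ **THEOREM 4's EXISTENCE INDUCTION AT ALL LEVELS FOR `P`-PERIODIC `U₀`, `U′` (gauge transformations carried by `Ω₀`, arbitrary gauge predicate `Lan`, sourced reset, edition γ′) —
EVERY SOCKET AT PERIODIC ARGUMENTS, EVERY OUTPUT PERIODIC**: `B8Prop3GaugeFixedKLevelSrcGammaPrime.thm4_exists_all_levels_supp_src_γ'` re-run on the periodicity-threaded driver
`B8Thm4SupportLocalPer.thm4_exists_all_levels_supp_per` with the reset served by §1 and (1.42) by dag-n05-w2's `H42_of_inAx_γ'` (unchanged).  The Prop-5 sockets `hP5base ∕ hP5` are asked at a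
PERIODIC level datum and must DELIVER a periodic `v` (a torus Proposition 5); the sourced in-edge `H59src` is asked at PERIODIC `(u, W, A′)` (a torus [4] Thm 3.3 with source).
CONCLUSION: for every `m ≤ k` a unitary-valued `P`-PERIODIC `u` with `u = 1` off `Ω₀`, (1.29) at `m` levels, the `P`-PERIODIC `W = U′^{u⁻¹}` with `Lan m W` (`m ≥ 1`), and a `P`-PERIODIC
exponent `A` with `W_b = e^{iηA_b}`, `A_b` self-adjoint, `‖A_b‖ ≤ c⋆(Lʲη)⁻¹` on the sides touching `Ω_j`, `j ≤ m`.
[cite: Balaban1985RegularSpaces, Thm 4 p.88, pp.88–89 + 94–95, Thm 8 (1.146) p.101, (1.38) p.82, Prop. 3 p.87, Prop. 5 p.94, p.77 («Ω_j ⊂ T_η»); Balaban1985BackgroundPropagators, Thm 3.3 p.398] -/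
theorem thm4_exists_all_levels_supp_src_γ'_per (hd2 : 2 ≤ d) {η : ℝ} (hη : 0 < η) {L : ℕ} (hL : 2 ≤ L) (k : ℕ)
    {U₀ U' : Site d → Fin d → 𝔸ˣ} (hU₀ : ∀ x κ, U₀ x κ ∈ unitaryUnits 𝔸) (hU' : ∀ x κ, U' x κ ∈ unitaryUnits 𝔸)
    -- the torus read on `ℤᵈ`: `U₀`, `U′` are `P`-periodic and so are the domains `Ω_j`, `j ≤ k`
    (P : ℕ) (hU₀p : IsPeriodic P U₀) (hU'p : IsPeriodic P U')
    {α₀ α₁ α₄ B₀ cstar a : ℝ} (hα₀ : 0 < α₀) (hα₁ : 0 < α₁) (hα₄ : 0 ≤ α₄) (hB₀ : 0 ≤ B₀)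
    {Ta Tg : ℝ} (hTa : 0 ≤ Ta) (hTg : 0 ≤ Tg) (hc : 5 * d * L * B₀ * (α₀ + α₁) + (Ta + Tg) ≤ cstar)
    (hs₁ : α₄ ≤ 1 / 84) (hs₂ : L * cstar ≤ 1 / 12) (ha : a ≤ 1 / 4) (ha2 : 2 * a ≤ cstar)
    -- [3] Prop. 4's linearisation windows ONE LEVEL LOWER (edition γ)
    (hα3 : C0 d * ((L : ℝ) ^ 2 * α₀) ≤ 1 / 3) (hα4 : 4 * ((L : ℝ) ^ 2 * α₀) ≤ c2' d L)
    (h16 : 16 * (2 * (L * cstar) + 8 * α₄) ≤ 1) (hd5 : 5 * (2 * (L * cstar) + 8 * α₄) * ((d : ℝ) - 1) ≤ 4)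
    (hsmall : Real.exp (4 * (800 * ((d : ℝ) + 1) ^ 2 * ((d : ℝ) + 4)) * ((L : ℝ) ^ 2 * α₀))
      * (1 + 8 * (131072 * ((d : ℝ) + 1) ^ 2) * ((L : ℝ) * (2 * (L * cstar) + 8 * α₄))) ≤ 2)
    (hc₃ : 2 * ((L : ℝ) * (2 * (L * cstar) + 8 * α₄)) ≤ c3 d L) (hside : 36 * d * B₀ * (2 * (L * cstar) + 8 * α₄) ≤ 1 / 2)
    (h50 : 50 * d * (2 * (L * cstar) + 8 * α₄) ≤ 1) (hsmall₁ : (d : ℝ) * L * α₁ ≤ 1 / 8)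
    (h16γ : 16 * ((L : ℝ) * (2 * (L * cstar) + 8 * α₄)) ≤ 1)
    {C₂ : ℝ} (hC₂ : 8 * (131072 * ((d : ℝ) + 1) ^ 2) * Real.exp (4 * (800 * ((d : ℝ) + 1) ^ 2 * ((d : ℝ) + 4)) * ((L : ℝ) ^ 2 * α₀)) * (L : ℝ) ^ 2 ≤ C₂)
    (h61 : 2 * (2 * (L * cstar) + 8 * α₄) ^ 2 + 20 * d * α₀ * (2 * (L * cstar) + 8 * α₄)
      + 2 * C₂ * (2 * (L * cstar) + 8 * α₄) ^ 2 ≤ α₀ + α₁)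
    (Ω : ℕ → Set (Site d)) (hΩ : ∀ j, Ω (j + 1) ⊆ Ω j) (Λs : ℕ → ℕ → Set (Site d)) (Λb : ℕ → ℕ → Set (Site d × Fin d))
    (hΩp : ∀ j, j ≤ k → IsPeriodic P (fun x : Site d => x ∈ Ω j))
    -- PRINT's box law (edition γ): the locality box of a level-`j` datum bond lies in `Ω_{j−1}` ((1.31); level 0: `Ω₀`)
    (hbox : ∀ m, m ≤ k → ∀ j, j ≤ m → ∀ c ∈ Λb m j, ∀ x, InBox (loK L j c.1) (bondHiK L j c.1 c.2) x → x ∈ Ω (j - 1))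
    (hclass : ∀ m, m ≤ k → ∀ j, j ≤ m → ∀ c ∈ Λb m j,
      (c.1 ∈ Λs m j ∧ c.1 + e c.2 ∈ Λs m j) ∨
      (∃ j', j = j' + 1 ∧ (∀ x, (L : ℤ) • c.1 ≤ x → x ≤ (L : ℤ) • c.1 + blockTop L → x ∈ Λs m j') ∧ c.1 + e c.2 ∈ Λs m j) ∨
      (∃ j', j = j' + 1 ∧ c.1 ∈ Λs m j ∧ (∀ x, (L : ℤ) • (c.1 + e c.2) ≤ x → x ≤ (L : ℤ) • (c.1 + e c.2) + blockTop L → x ∈ Λs m j')))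
    (h33 : InAk L k η α₀ Ω U₀) (h34 : InAk L k η α₀ Ω (mulCfg U' U₀))
    (hAx : ∀ m, m ≤ k → InAx L m (Λs m) U₀ (mulCfg U' U₀))
    -- the tower law AT EVERY TRUNCATION `m ≤ k`: the `j`-block of every site of `Λs m j` lies in `Ω_j` ((1.5)–(1.6) p. 77; `IdxB8Sub.tower_all`)
    (htw : ∀ m, m ≤ k → ∀ j, j ≤ m → ∀ y ∈ Λs m j, ∀ x, InBox (tlo L y j) (thi L y j) x → x ∈ Ω j)
    -- (1.35) in PRINT's class (p. 77 «at least one end-point of b belongs to Ω»): every level-`j` bond with an end-BLOCK inside `Ω_j` (edition γ′, dag-n05-w2)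
    (h135 : ∀ j, j ≤ k → ∀ (z : Site d) (μ : Fin d),
      ((∀ x, InBox (tlo L z j) (thi L z j) x → x ∈ Ω j) ∨ (∀ x, InBox (tlo L (z + e μ) j) (thi L (z + e μ) j) x → x ∈ Ω j)) →
      ‖(avgIter L (mulCfg U' U₀) j z μ : 𝔸) - (avgIter L U₀ j z μ : 𝔸)‖ ≤ α₁)
    (h66 : ∀ b ∈ {b : Site d × Fin d | SideTouches (Ω 0) b.1 b.2}, ‖((U' b.1 b.2 : 𝔸ˣ) : 𝔸) - 1‖ ≤ a)
    (Lan : ℕ → (Site d → Fin d → 𝔸ˣ) → Prop)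
    (hP5base : ∃ (v : Site d → 𝔸ˣ) (lam : Site d → 𝔸), (∀ x, v x ∈ unitaryUnits 𝔸) ∧ (∀ x, x ∉ Ω 0 → v x = 1) ∧
        (∀ j, j ≤ 1 → ∀ b ∈ {b : Site d × Fin d | SideTouches (Ω j) b.1 b.2}, (v b.1 : 𝔸) = ((gaugeExp lam b.1 : 𝔸ˣ) : 𝔸) ∧
          (v (b.1 + e b.2) : 𝔸) = ((gaugeExp lam (b.1 + e b.2) : 𝔸ˣ) : 𝔸)) ∧
        (∀ j, j ≤ 1 → ∀ b ∈ {b : Site d × Fin d | SideTouches (Ω j) b.1 b.2},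
          ‖lam b.1‖ ≤ α₄ ∧ ((L : ℝ) ^ j * η) * ‖covDerivFwd η U₀ b.2 lam b.1‖ ≤ α₄) ∧
        Lan 1 (mgauge U₀ v⁻¹ U') ∧ Restr129 L 1 (Λs 1) U₀ ((1 : Site d → 𝔸ˣ) * v) ∧ IsPeriodic P v)
    (hP5 : ∀ m, 1 ≤ m → m < k → ∀ (u₁ : Site d → 𝔸ˣ) (U₁ : Site d → Fin d → 𝔸ˣ) (A : Site d → Fin d → 𝔸),
      (∀ x, u₁ x ∈ unitaryUnits 𝔸) → (∀ x, x ∉ Ω 0 → u₁ x = 1) → IsPeriodic P u₁ → IsPeriodic P U₁ → IsPeriodic P A →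
      mgauge U₀ u₁ U₁ = U' → Restr129 L m (Λs m) U₀ u₁ → Lan m U₁ →
      (∀ j, j ≤ m → ∀ b ∈ {b : Site d × Fin d | SideTouches (Ω j) b.1 b.2},
        U₁ b.1 b.2 = cfgExp η A b.1 b.2 ∧ IsSelfAdjoint (A b.1 b.2) ∧ ‖A b.1 b.2‖ ≤ cstar * ((L : ℝ) ^ j * η)⁻¹) →
      ∃ (v : Site d → 𝔸ˣ) (lam : Site d → 𝔸), (∀ x, v x ∈ unitaryUnits 𝔸) ∧ (∀ x, x ∉ Ω 0 → v x = 1) ∧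
        (∀ j, j ≤ m + 1 → ∀ b ∈ {b : Site d × Fin d | SideTouches (Ω j) b.1 b.2}, (v b.1 : 𝔸) = ((gaugeExp lam b.1 : 𝔸ˣ) : 𝔸) ∧
          (v (b.1 + e b.2) : 𝔸) = ((gaugeExp lam (b.1 + e b.2) : 𝔸ˣ) : 𝔸)) ∧
        (∀ j, j ≤ m + 1 → ∀ b ∈ {b : Site d × Fin d | SideTouches (Ω j) b.1 b.2},
          ‖lam b.1‖ ≤ α₄ ∧ ((L : ℝ) ^ j * η) * ‖covDerivFwd η U₀ b.2 lam b.1‖ ≤ α₄) ∧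
        Lan (m + 1) (mgauge U₀ v⁻¹ U₁) ∧ Restr129 L (m + 1) (Λs (m + 1)) U₀ (u₁ * v) ∧ IsPeriodic P v)
    (H59src : ∀ m, 1 ≤ m → m ≤ k → ∀ (u : Site d → 𝔸ˣ) (W : Site d → Fin d → 𝔸ˣ) (A' : Site d → Fin d → 𝔸),
      (∀ x, u x ∈ unitaryUnits 𝔸) → IsPeriodic P u → IsPeriodic P W → IsPeriodic P A' →
      mgauge U₀ u W = U' → Restr129 L m (Λs m) U₀ u → Lan m W →
      (∀ y τ, IsSelfAdjoint (A' y τ)) →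
      (∀ j, j ≤ m → ∀ y τ, SideTouches (Ω j) y τ →
        W y τ = cfgExp η A' y τ ∧ ‖A' y τ‖ ≤ (2 * (L * cstar) + 8 * α₄) * ((L : ℝ) ^ j * η)⁻¹) →
      (∀ y τ, (∀ j, j ≤ m → ¬ SideTouches (Ω j) y τ) → A' y τ = 0) →
      msup L m η (-(1 : ℝ)) (fun j (b : Site d × Fin d) => SideTouches (Ω j) b.1 b.2) (fun b => A' b.1 b.2)
          ≤ B₀ * (bondNorm L m η (-(3 : ℝ)) Ω (fun x μ => Jcur η U₀ A' μ x)
            + wsup 1 (fun p : {p : ℕ × (Site d × Fin d) // p.1 ≤ m ∧ p.2 ∈ Λb m p.1} =>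
                linCovIter L U₀ (iEta η A') p.1.1 p.1.2.1 p.1.2.2)) + Ta ∧
        msup L m η (-(2 : ℝ)) (fun j (t : Fin d × Fin d × Site d) => SideTouches (Ω j) t.2.2 t.2.1)
            (fun t => covDerivFwd η U₀ t.1 (fun z => A' z t.2.1) t.2.2)
          ≤ B₀ * (bondNorm L m η (-(3 : ℝ)) Ω (fun x μ => Jcur η U₀ A' μ x)
            + wsup 1 (fun p : {p : ℕ × (Site d × Fin d) // p.1 ≤ m ∧ p.2 ∈ Λb m p.1} =>
                linCovIter L U₀ (iEta η A') p.1.1 p.1.2.1 p.1.2.2)) + Tg) :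
    ∀ m, m ≤ k → ∃ u : Site d → 𝔸ˣ, (∀ x, u x ∈ unitaryUnits 𝔸) ∧ (∀ x, x ∉ Ω 0 → u x = 1) ∧ IsPeriodic P u ∧ Restr129 L m (Λs m) U₀ u ∧
      ∃ W : Site d → Fin d → 𝔸ˣ, mgauge U₀ u W = U' ∧ (1 ≤ m → Lan m W) ∧ IsPeriodic P W ∧
        ∃ A : Site d → Fin d → 𝔸, IsPeriodic P A ∧ ∀ j, j ≤ m → ∀ b ∈ {b : Site d × Fin d | SideTouches (Ω j) b.1 b.2},
          W b.1 b.2 = cfgExp η A b.1 b.2 ∧ IsSelfAdjoint (A b.1 b.2) ∧ ‖A b.1 b.2‖ ≤ cstar * ((L : ℝ) ^ j * η)⁻¹ := by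
  have hL1 : 1 ≤ L := le_trans (by norm_num) hL
  have hcstar : 0 ≤ cstar := le_trans (by positivity) hc
  have hα₂ : 0 ≤ 2 * (L * cstar) + 8 * α₄ := by positivity
  have hE : ∀ j, {b : Site d × Fin d | SideTouches (Ω (j + 1)) b.1 b.2} ⊆ {b : Site d × Fin d | SideTouches (Ω j) b.1 b.2} :=
    fun j b hb => B8Eq140Level.sideTouches_mono (hΩ j) hb
  exact thm4_exists_all_levels_supp_per hL1 hη (Ω 0) P hU₀ hU' hU₀p hU'p hcstar hα₄ hs₁ hs₂ ha ha2
    (fun j => {b : Site d × Fin d | SideTouches (Ω j) b.1 b.2}) hE h66 Λs Lan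
    hP5base hP5
    (hP3_gaugeFixed_of_b9_src_γ_per hd2 hη hL k hU₀ hU' hα₀ hα₁.le hα₄ hB₀ hTa hTg hc hα3 hα4 h16 hd5 hsmall hc₃ hside h50 hC₂ h61 Ω Λs Λb
      P hΩp hbox h33 h34 Lan
      (fun m hm1 hmk => B8Eq142KLevelLocalGammaPrime.H42_of_inAx_γ' hd2 hη hL k hU₀ hα₀ hα₁ hα₂ hα3 hα4 h16γ hsmall hc₃ hsmall₁ Ω hΩ Λs Λb
        hbox hclass h33 h34 hAx h135 Lan m hm1 hmk (htw m hmk))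
      H59src)

end Composition

end Literature.MathematicalPhysics.QuantumFieldTheory.Balaban1983to89.B8Prop3GaugeFixedKLevelSrcGammaPer

end
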